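import Summits.CriticalPhenomena.PercolationContinuityZ3.Theses.PercNearOneGluing
import Literature.Probability.Percolation.PercolationProofs
import Literature.Probability.Percolation.ConditionalPositiveAssociationProofs
import Literature.Probability.Percolation.TwoClusterConditionalAssociationProofs
import Summits.CriticalPhenomena.PercolationContinuityZ3.Theorems.PercNearOneGluingAdditiveGluingGoodTwoRelays

/-! TTRL-lite variant V2094 of stmt-CriticalPhenomena-4576

(`stub_goodStep`, move `specialise+small_case`: `n := 8` and `A.card = 2`).  With `b ∈ A` and
`A.card = 2` the relay set is `A = {a, b}` (one relay besides the target), so the additive gluing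
good step is the union bound through the unique relay `a`: the `sel W = b` pocket terms vanish
(`b ↔ b in Wᶜ` for `b ∉ W`), the `sel W = a` pocket terms decouple by the pocket Markov property
into `μ(C(o) = W, a ↮ b)`, and `{o ↔ A, o ↮ b} ⊆ {a ↮ b}`; altogether `≤ μ(a ↮ b) ≤ t`.  This is a
special case of the proved two-relay good step `stub_goodStepTwoRelays_k41` (`A.card ≤ 3`, any
`n`); the non-degeneracy hypothesis and the induction hypothesis are discarded.  No new
definitions, no named facts. -/

namespace Summit.CriticalPhenomena.PercolationContinuityZ3.Theorems

open MeasureTheory Literature.Probability.LatticeModels Literature.Probability.Percolation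
open scoped Classical BigOperators

/-- TTRL-lite variant V2094 of `stub_goodStep` (stmt-CriticalPhenomena-4576): the `n = 8`,
`A.card = 2` specialisation of the additive gluing good step (linear selection form of
Kozma–Nitzan's good-quadruple inequality).  Since `A.card = 2 ≤ 3`, it is a special case of the
proved two-relay good step `stub_goodStepTwoRelays_k41`; the non-degeneracy and induction
hypotheses are not used. -/
theorem stub_goodStep_var2094 : ∀ (w : Sym2 (Fin 8) → unitInterval) (A : Finset (Fin 8)) (o b : Fin 8), A.card = 2 → b ∈ A → o ∉ A → (∃ y : Fin 8, y ∉ A ∧ y ≠ o ∧ (w s(o, y) : ℝ) ≠ 0) → (∀ w' : Sym2 (Fin 8) → unitInterval, (Finset.univ.filter (fun v : Fin 8 => ∃ u : Fin 8, 0 < (w' s(u, v) : ℝ))).card < (Finset.univ.filter (fun v : Fin 8 => ∃ u : Fin 8, 0 < (w s(u, v) : ℝ))).card → ∀ (A' : Finset (Fin 8)) (o' b' : Fin 8), b' ∈ A' → o' ∉ A' → ∀ (t : ℝ) (sel : Finset (Fin 8) → Fin 8), (∀ W, sel W ∈ A') → (∀ a ∈ A', 1 - t ≤ (prodBernoulli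 w').real (openConn a b')) → (prodBernoulli w').real ((⋃ a ∈ A', openConn o' a) ∩ (openConn o' b')ᶜ) + ∑ W ∈ (Finset.univ : Finset (Finset (Fin 8))).filter (fun W => o' ∈ W ∧ Disjoint W A'), (prodBernoulli w').real {ω : BondConfig (Fin 8) | openCluster ω o' = (W : Set (Fin 8))} * (prodBernoulli w').real (openConnIn ((W : Set (Fin 8))ᶜ) (sel W) b')ᶜ ≤ t) → ∀ (t : ℝ) (sel : Finset (Fin 8) → Fin 8), (∀ W, sel W ∈ A) → (∀ a ∈ A, 1 - t ≤ (prodBernoulli w).real (openConn a b)) → (prodBernoulli w).real ((⋃ a ∈ A, openConn o a) ∩ (openConn o b)ᶜ) + ∑ W ∈ (Finset.univ : Finset (Finset (Fin 8))).filter (fun W => o ∈ W ∧ Disjoint W A), (prodBernoulli w).real {ω : BondConfig (Fin 8) | openCluster ω o = (W : Set (Fin 8))} * (prodBernoulli w).real (openConnIn ((W : Set (Fin 8))ᶜ) (sel W) b)ᶜ ≤ t := by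
  intro w A o b hcard hbA hoA _hy _hIH t sel hsel hlev
  exact stub_goodStepTwoRelays_k41 8 w A o b hbA hoA (by omega) t sel hsel hlev

end Summit.CriticalPhenomena.PercolationContinuityZ3.Theorems
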